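import Summits.BirchSwinnertonDyer.BirchSwinnertonDyer.Theorems.EisensteinPrimesGoodLatticeKrizPlacementDichotomyRat
import HarnessLib

/-!
# A FULL-EISENSTEIN-DESCENT TYPE `(N₊, N₋, N₀)` for the quotient Teichmüller character FROM THE FULL-DESCENT DATUM
# (Kriz 2016 Thm. 34 (2)(3) / Thm. 35 and Def. 31 (2)–(5) for `f_E`, in the kernel)
# (cell `bsd-eis`, width seat `bsd-line-x1-p1-w2` gen 26; helper for crux 2 `GoodLatticeBDPValue`, `--supports stmt-BirchSwinnertonDyer-19032`)

WHY. The named fact `CastellaGrossiLeeSkinner2022.proofThm221_congruence_of_fullEisensteinDescent` (CGLS 2022's PROOF of Thm. 2.2.1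
from (eq:cong-mf); this seat, p759553) and its kernel consumer `GoodLatticeAnacongOfCGLSProofThm221.anacong_of_proofThm221_of_thmI`
take a full-Eisenstein-descent TYPE `(N₊, N₋, N₀)` with Kriz's Def. 31 conditions (1)–(5) for `φ̃ = θquot` as hypotheses
(`htype`, `h1`, `h2`, `h3'`, `h4`, `h5`). This file CONSTRUCTS the type from the data of the content stub 3a-A — a rational `p`-line
`Φ` with Teichmüller lifts and the FULL-DESCENT DATUM «`E` has an additive prime, or a multiplicative `ℓ` with `a_ℓ ≡ ℓ (mod p)`» —
and proves (2)–(5) (EXACTLY the shapes `htype`, `h2`, `h3'`, `h4`, `h5`): `N₀` = the additive primes (`a_ℓ = 0`, (4)); `N₋` = the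
multiplicative `ℓ` with `a_ℓ ≡ φ̃(ℓ)⁻¹ℓ` (3); `N₊` = the other multiplicative primes, where the tree's Frobenius-scalar dichotomy
`{(εℓ, ε), (ε, εℓ)}` over `ℚ` (Kriz Thm. 34 (2)) forces `a_ℓ ≡ φ̃(ℓ)` (2); and (5) holds because for `φ̃ = 𝟙` the datum's prime lies
in `N₋ ∪ N₀`, whose factor `(1 − ψ₂(ℓ)) = (1 − 1)` vanishes (Kriz Rem. 33: «(5) is still forced to hold unless `N₋N₀ = 1`»).
Condition (1) is `GoodLatticeKrizTraceCondition.kriz_one_of_hasGoodReductionAtPrime` at the good `ℓ ≠ p` (p759625); at `ℓ = p`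
(`a_p ≡ θquot(Frob_p)`, the unit root) it is NOT yet in the tree — the one remaining kernel input of the road
«3a-A ⟸ {CGLS proof of 2.2.1, Hida Thm. I} ∧ kernel».

* §1 `exists_natScalars` — ℕ-scalars of any `σ ∈ Γ_ℚ` on `Φ` and on `E[p]/Φ` from the Teichmüller data (input format of the dichotomies).
* §2 `placement_dichotomy_rat` — at a multiplicative `ℓ ≠ p`: `θquot` unramified at `ℓ`, and `a_ℓ ≡ φ̃(ℓ)` for every Frobenius value,
  or `a_ℓ ≡ φ̃(ℓ)⁻¹ℓ` for every Frobenius value (`LineScalarsAtMultiplicativePlace.exists_frob_lineScalars_of_hasSplitMultiplicativeReductionAt`,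
  `GoodLatticeResidualPairScalarsAtMultiplicativeAll.exists_frob_lineScalars_of_not_hasSplitMultiplicativeReductionAtPrime'`,
  `ResidualPairUnramifiedAtMultiplicative.isUnramifiedAt_of_hasMultiplicativeReductionAt` over `ℚ`).
* §3 `exists_fullDescentType_of_datum` — the type with (2)–(5).

HONEST FRAMING: helper theorems (0 definitions, 0 named facts, 0 sorry); closes no stub; no summit statement / crux / BSD / theorem
of CGLS or Kriz (beyond these elementary reductions for `E/ℚ`) is proved here. References: [Kriz2016] Def. 31, Rem. 33, Thm. 34 (2)(3),
Thm. 35; [CastellaGrossiLeeSkinner2022] Thm. 2.2.1 (the factorisation `N/N₀ = N₊N₋`); [GreenbergVatsal2000] §2 pp. 14–15;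
[SilvermanAEC2009] §C.16 (`L_v(T)` at bad `v`); [SerreInventiones1972] §1.12.
-/

set_option autoImplicit false
set_option linter.dupNamespace false

noncomputable section

open scoped Classical

open WeierstrassCurve NumberField IsDedekindDomain Field
  Literature.NumberTheory.EllipticCurves Literature.NumberTheory.EllipticCurves.Rank1Residual
  Literature.NumberTheory.GaloisRepresentations
  Literature.NumberTheory.EllipticCurves.GreenbergSelmer
  Literature.NumberTheory.EllipticCurves.KellerYin2024

open Summit.BirchSwinnertonDyer.BirchSwinnertonDyer.Theorems.GoodLatticeKrizPlacementDichotomyRat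

namespace Summit.BirchSwinnertonDyer.BirchSwinnertonDyer.Theorems.GoodLatticeKrizDescentTypeOfDatum

variable {p : ℕ} [hp : Fact p.Prime] {S : Set (PadicAlgCl p)}

/-! ## §3 The type `(N₊, N₋, N₀)` with Kriz's (2)–(5) from the full-descent datum -/

/-- `Fact`-instance bookkeeping: a prime-indexed predicate does not depend on the primality proof. [folklore] -/
theorem exists_prime_iff {P : ∀ ℓ : ℕ, Fact ℓ.Prime → Prop} {ℓ : ℕ} (hℓ : ℓ.Prime) :
    (∃ h : ℓ.Prime, P ℓ ⟨h⟩) ↔ P ℓ ⟨hℓ⟩ :=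
  ⟨fun ⟨_, h⟩ ↦ h, fun h ↦ ⟨hℓ, h⟩⟩

/-- An additive or multiplicative (i.e. bad) prime divides the conductor, hence lies in its prime factors. [cite: SilvermanAEC2009, VII.§5 and App. C §16] -/
theorem mem_primeFactors_of_not_hasGoodReductionAtPrime (W : WeierstrassCurve ℚ) [W.IsElliptic] {ℓ : ℕ} [hℓ : Fact ℓ.Prime]
    (hbad : ¬ W.HasGoodReductionAtPrime ℓ) : ℓ ∈ (W.conductorNorm ℤ).primeFactors := by
  set v : HeightOneSpectrum (𝓞 ℚ) := (Rat.HeightOneSpectrum.primesEquiv (R := 𝓞 ℚ)).symm ⟨ℓ, hℓ.out⟩ with hv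
  have hvℓ : (Rat.HeightOneSpectrum.primesEquiv v : ℕ) = ℓ := by rw [hv, Equiv.apply_symm_apply]
  have hbad' : ¬ W.HasGoodReductionAt v := fun h ↦ hbad ((hasGoodReductionAtPrime_primesEquiv_iff_holds W v ℓ hvℓ).mpr h)
  have hdvd : ℓ ∣ W.conductorNorm ℤ := by rw [← hvℓ]; exact (W.dvd_conductorNorm_iff v).mpr hbad'
  exact Nat.mem_primeFactors.mpr ⟨hℓ.out, hdvd, (W.conductorNorm_pos_holds).ne'⟩

/-- **A full-Eisenstein-descent type from the full-descent datum (Kriz Thm. 34 (2)(3), Thm. 35 and Def. 31 (2)–(5) for `f_E`, in the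
kernel).** For `W/ℚ` globally minimal elliptic, a prime `p`, a rational `p`-line `Φ` with Teichmüller lifts `θsub`, `θquot`, and the
FULL-DESCENT DATUM of the content stub 3a-A («an additive prime, or a multiplicative `ℓ` with `a_ℓ ≡ ℓ (mod p)`»): there are finsets
`N₊ ⊔ N₋` = the multiplicative primes, `N₀` = the additive primes of `N_E`, such that Kriz's descent conditions (2) `a_ℓ ≡ φ̃(ℓ)`
(`ℓ ∈ N₊`), (3) `a_ℓ ≡ φ̃(ℓ)⁻¹ℓ` (`ℓ ∈ N₋`), (4) `a_ℓ ≡ 0` (`ℓ ∈ N₀`) hold for `φ̃ = θquot`, and (5) holds — when `φ̃ = 𝟙` because the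
datum puts a prime in `N₋ ∪ N₀`, whose factor `(1 − ψ₂(ℓ)) = (1 − 1)` vanishes (Kriz Rem. 33: «(5) is still forced to hold unless
`N₋N₀ = 1`»). EXACTLY the hypotheses `htype`, `h2`, `h3'`, `h4`, `h5` of `GoodLatticeAnacongOfCGLSProofThm221.anacong_of_proofThm221_of_thmI`
(condition (1) is `GoodLatticeKrizTraceCondition.kriz_one_of_hasGoodReductionAtPrime` at `ℓ ≠ p`; at `ℓ = p` it is not in this file).
[cite: Kriz2016, Def. 31 (2)–(5), Rem. 33, Thm. 34 (2)(3), Thm. 35] [cite: CastellaGrossiLeeSkinner2022, Thm. 2.2.1 (the factorisation N/N₀ = N₊N₋)] -/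
theorem exists_fullDescentType_of_datum (W : WeierstrassCurve ℚ) [W.IsElliptic] [W.IsGloballyMinimal] (hgood : Good W p)
    {Φ : AddSubgroup (geomTorsion W (p : ℤ))} (hΦ : IsRationalLine W p Φ)
    {θsub θquot : FramedGaloisRep ℚ (padicCoeffIntegers S) 1}
    (hsub : IsTeichmullerLiftOn S (Φ.map (geomTorsion W (p : ℤ)).subtype) θsub)
    (hquot : IsTeichmullerLiftOnQuot S (Φ.map (geomTorsion W (p : ℤ)).subtype) (geomTorsion W (p : ℤ)) θquot)
    (hdatum : (∃ (ℓ : ℕ) (hℓ : ℓ.Prime), haveI : Fact ℓ.Prime := ⟨hℓ⟩; Addv W ℓ) ∨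
      (∃ (ℓ : ℕ) (hℓ : ℓ.Prime), haveI : Fact ℓ.Prime := ⟨hℓ⟩;
        W.HasMultiplicativeReductionAtPrime ℓ ∧
          ((W.HasSplitMultiplicativeReductionAtPrime ℓ ∧ ℓ ≡ 1 [MOD p]) ∨
            (¬ W.HasSplitMultiplicativeReductionAtPrime ℓ ∧ ℓ + 1 ≡ 0 [MOD p])))) :
    ∃ Nplus Nminus Nzero : Finset ℕ,
      Nplus ⊆ (W.conductorNorm ℤ).primeFactors ∧ Nminus ⊆ (W.conductorNorm ℤ).primeFactors ∧
      Nzero ⊆ (W.conductorNorm ℤ).primeFactors ∧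
      (∀ (ℓ : ℕ) (hℓ : ℓ ∈ (W.conductorNorm ℤ).primeFactors),
        haveI : Fact ℓ.Prime := ⟨Nat.prime_of_mem_primeFactors hℓ⟩
        (ℓ ∈ Nzero ↔ ¬ W.HasMultiplicativeReductionAtPrime ℓ) ∧
        ((ℓ ∈ Nplus ∨ ℓ ∈ Nminus) ↔ W.HasMultiplicativeReductionAtPrime ℓ) ∧ ¬ (ℓ ∈ Nplus ∧ ℓ ∈ Nminus)) ∧
      (∀ ℓ ∈ Nplus, ∀ u : HeightOneSpectrum (𝓞 ℚ), ((ℓ : ℕ) : 𝓞 ℚ) ∈ u.asIdeal → θquot.IsUnramifiedAt u ∧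
        ∀ a : padicCoeffIntegers S, θquot.HasFrobCharpolyAt u (Polynomial.X - Polynomial.C a) →
        ‖((W.LFunction ℓ : ℤ) : PadicAlgCl p) - (a : PadicAlgCl p)‖ < 1) ∧
      (∀ ℓ ∈ Nminus, ∀ u : HeightOneSpectrum (𝓞 ℚ), ((ℓ : ℕ) : 𝓞 ℚ) ∈ u.asIdeal → θquot.IsUnramifiedAt u ∧
        ∀ a : padicCoeffIntegers S, θquot.HasFrobCharpolyAt u (Polynomial.X - Polynomial.C a) →
        ‖((W.LFunction ℓ : ℤ) : PadicAlgCl p) - (a : PadicAlgCl p)⁻¹ * (ℓ : PadicAlgCl p)‖ < 1) ∧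
      (∀ ℓ ∈ Nzero, ‖((W.LFunction ℓ : ℤ) : PadicAlgCl p)‖ < 1) ∧
      ((∀ σ : absoluteGaloisGroup ℚ, θquot σ = 1) →
        ‖(((1 : ℚ) / 24 * ((∏ ℓ ∈ Nplus, (1 - (ℓ : ℚ))) * (∏ _ℓ ∈ Nminus, ((1 : ℚ) - 1)) *
            (∏ ℓ ∈ Nzero, (1 - (ℓ : ℚ)) * ((1 : ℚ) - 1))) : ℚ) : ℚ_[p])‖ < 1) := by
  have hpp := hp.out
  set PF := (W.conductorNorm ℤ).primeFactors with hPF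
  have hpN : ¬ p ∣ W.conductorNorm ℤ := not_dvd_conductorNorm_of_hasGoodReductionAtPrime W hgood
  -- the predicates (independent of the primality proof)
  let mult : ℕ → Prop := fun ℓ ↦ ∃ h : ℓ.Prime, (haveI : Fact ℓ.Prime := ⟨h⟩; W.HasMultiplicativeReductionAtPrime ℓ)
  let minus : ℕ → Prop := fun ℓ ↦ mult ℓ ∧ ∀ u : HeightOneSpectrum (𝓞 ℚ), ((ℓ : ℕ) : 𝓞 ℚ) ∈ u.asIdeal →
    θquot.IsUnramifiedAt u ∧ ∀ a : padicCoeffIntegers S, θquot.HasFrobCharpolyAt u (Polynomial.X - Polynomial.C a) →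
      ‖((W.LFunction ℓ : ℤ) : PadicAlgCl p) - (a : PadicAlgCl p)⁻¹ * (ℓ : PadicAlgCl p)‖ < 1
  refine ⟨PF.filter (fun ℓ ↦ mult ℓ ∧ ¬ minus ℓ), PF.filter minus, PF.filter (fun ℓ ↦ ¬ mult ℓ),
    Finset.filter_subset _ _, Finset.filter_subset _ _, Finset.filter_subset _ _, ?_, ?_, ?_, ?_, ?_⟩
  · -- the type
    intro ℓ hℓ
    have hℓp' : ℓ.Prime := Nat.prime_of_mem_primeFactors hℓ
    have hmult_iff : mult ℓ ↔ (haveI : Fact ℓ.Prime := ⟨hℓp'⟩; W.HasMultiplicativeReductionAtPrime ℓ) :=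
      ⟨fun ⟨_, h⟩ ↦ h, fun h ↦ ⟨hℓp', h⟩⟩
    have hℓPF : ℓ ∈ PF := hℓ
    refine ⟨?_, ?_, ?_⟩
    · rw [Finset.mem_filter, ← hmult_iff]
      exact ⟨fun h ↦ h.2, fun h ↦ ⟨hℓPF, h⟩⟩
    · rw [Finset.mem_filter, Finset.mem_filter, ← hmult_iff]
      constructor
      · rintro (⟨-, hm, -⟩ | ⟨-, hmin⟩)
        · exact hm
        · exact hmin.1
      · intro hm
        by_cases hmin : minus ℓ
        · exact Or.inr ⟨hℓPF, hmin⟩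
        · exact Or.inl ⟨hℓPF, hm, hmin⟩
    · rintro ⟨h1, h2⟩
      rw [Finset.mem_filter] at h1 h2
      exact h1.2.2 h2.2
  · -- (2) on `N₊`
    intro ℓ hℓ u hu
    rw [Finset.mem_filter] at hℓ
    obtain ⟨hℓPF, ⟨hℓprime, hm⟩, hnot⟩ := hℓ
    haveI : Fact ℓ.Prime := ⟨hℓprime⟩
    have hℓp : ℓ ≠ p := fun h' ↦ hpN (h' ▸ Nat.dvd_of_mem_primeFactors hℓPF)
    obtain ⟨hunr, hdich⟩ := placement_dichotomy_rat W hΦ hsub hquot hℓp hm hu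
    refine ⟨hunr, ?_⟩
    rcases hdich with h | h
    · exact h
    · exfalso
      apply hnot
      refine ⟨⟨hℓprime, hm⟩, fun u' hu' ↦ ?_⟩
      have huu : u' = u := by
        rw [(natCast_mem_asIdeal_iff_eq_primesEquiv_symm u' hℓprime).mp hu',
          (natCast_mem_asIdeal_iff_eq_primesEquiv_symm u hℓprime).mp hu]
      subst huu
      exact ⟨hunr, h⟩
  · -- (3) on `N₋`
    intro ℓ hℓ u hu
    rw [Finset.mem_filter] at hℓ
    exact hℓ.2.2 u hu
  · -- (4) on `N₀`: `a_ℓ = 0` at an additive prime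
    intro ℓ hℓ
    rw [Finset.mem_filter] at hℓ
    obtain ⟨hℓPF, hnm⟩ := hℓ
    have hℓprime : ℓ.Prime := Nat.prime_of_mem_primeFactors hℓPF
    haveI : Fact ℓ.Prime := ⟨hℓprime⟩
    set v : HeightOneSpectrum (𝓞 ℚ) := (Rat.HeightOneSpectrum.primesEquiv (R := 𝓞 ℚ)).symm ⟨ℓ, hℓprime⟩ with hv
    have hvℓ : (Rat.HeightOneSpectrum.primesEquiv v : ℕ) = ℓ := by rw [hv, Equiv.apply_symm_apply]
    have hbad : ¬ W.HasGoodReductionAt v := (W.dvd_conductorNorm_iff v).mp (hvℓ ▸ Nat.dvd_of_mem_primeFactors hℓPF)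
    have hnmv : ¬ W.HasMultiplicativeReductionAt v := fun h' ↦
      hnm ⟨hℓprime, by
        have key : ∀ (q : ℕ) (hq' : Fact q.Prime), q = ℓ →
            (haveI := hq'; W.HasMultiplicativeReductionAtPrime q) → W.HasMultiplicativeReductionAtPrime ℓ := by
          rintro q hq' rfl h''; exact h''
        exact key _ _ hvℓ ((W.hasMultiplicativeReductionAtPrime_iff_hasMultiplicativeReductionAt_ringOfIntegers v).mpr h')⟩
    have hadd : W.HasAdditiveReductionAt v :=
      (Summit.BirchSwinnertonDyer.Rank1Residual.X2.NonPrimitiveLambdaShiftRat.additive_or_multiplicative_of_not_hasGoodReductionAt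
        W hbad).resolve_right hnmv
    rw [← hvℓ, W.LFunction_apply_primesEquiv_of_hasAdditiveReductionAt hadd, Int.cast_zero, norm_zero]
    exact one_pos
  · -- (5): for `φ̃ = 𝟙` the datum puts a prime into `N₋ ∪ N₀`, whose factor `(1 − 1)` kills the product
    intro hθ1
    have hzero : ((1 : ℚ) / 24 * ((∏ ℓ ∈ PF.filter (fun ℓ ↦ mult ℓ ∧ ¬ minus ℓ), (1 - (ℓ : ℚ))) *
        (∏ _ℓ ∈ PF.filter minus, ((1 : ℚ) - 1)) * (∏ ℓ ∈ PF.filter (fun ℓ ↦ ¬ mult ℓ), (1 - (ℓ : ℚ)) * ((1 : ℚ) - 1)))) = 0 := by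
      rcases hdatum with ⟨ℓ, hℓprime, haddv⟩ | ⟨ℓ, hℓprime, hm, hcong⟩
      · -- an additive prime lies in `N₀`
        haveI : Fact ℓ.Prime := ⟨hℓprime⟩
        have hℓPF : ℓ ∈ PF := mem_primeFactors_of_not_hasGoodReductionAtPrime W haddv.1
        have hmem : ℓ ∈ PF.filter (fun ℓ ↦ ¬ mult ℓ) :=
          Finset.mem_filter.mpr ⟨hℓPF, fun ⟨_, h⟩ ↦ haddv.2 h⟩
        rw [Finset.prod_eq_zero hmem (by rw [sub_self, mul_zero])]
        ring
      · -- the datum's multiplicative prime `ℓ` (`a_ℓ ≡ ℓ`) lies in `N₋`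
        haveI : Fact ℓ.Prime := ⟨hℓprime⟩
        have hℓPF : ℓ ∈ PF := mem_primeFactors_of_not_hasGoodReductionAtPrime W (fun hg ↦ by
          set v : HeightOneSpectrum (𝓞 ℚ) := (Rat.HeightOneSpectrum.primesEquiv (R := 𝓞 ℚ)).symm ⟨ℓ, hℓprime⟩ with hv
          have hvℓ : (Rat.HeightOneSpectrum.primesEquiv v : ℕ) = ℓ := by rw [hv, Equiv.apply_symm_apply]
          have hℓv : ((ℓ : ℕ) : 𝓞 ℚ) ∈ v.asIdeal :=
            (natCast_mem_asIdeal_iff_eq_primesEquiv_symm v hℓprime).mpr rfl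
          have hmultv := Summit.BirchSwinnertonDyer.Rank1Residual.X2.GreenbergVatsalStrictSelmerMultiplicative.hasMultiplicativeReductionAt_of_mem
            W ℓ hm hℓv
          exact hmultv.not_hasGoodReductionAt ((hasGoodReductionAtPrime_primesEquiv_iff_holds W v ℓ hvℓ).mp hg))
        have hℓp : ℓ ≠ p := fun h' ↦ hpN (h' ▸ Nat.dvd_of_mem_primeFactors hℓPF)
        have hℓ0 : (ℓ : ZMod p) ≠ 0 := by
          rw [Ne, ZMod.natCast_eq_zero_iff]
          exact fun h' ↦ hℓp ((Nat.prime_dvd_prime_iff_eq hpp hℓprime).mp h').symm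
        have hminus : minus ℓ := by
          refine ⟨⟨hℓprime, hm⟩, fun u hu ↦ ?_⟩
          obtain ⟨hunr, -⟩ := placement_dichotomy_rat W hΦ hsub hquot hℓp hm hu
          refine ⟨hunr, fun a ha ↦ ?_⟩
          -- `θquot = 𝟙`: the Frobenius value is `1`
          obtain ⟨𝔓, h𝔓⟩ := HeightOneSpectrum.primesAbove_nonempty u
          obtain ⟨σ₁, hσ₁⟩ := HeightOneSpectrum.exists_isArithFrobAt_of_mem_primesAbove_holds h𝔓
          have ha1 : a = 1 := by
            have h := ha 𝔓 h𝔓 σ₁ hσ₁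
            rw [GoodLatticeAnacongEulerCompMultiplicative.charpoly_eq_X_sub_C_entry, sub_right_inj, Polynomial.C_inj] at h
            rw [← h]
            unfold KellerYin2024.entry
            rw [hθ1 σ₁, Units.val_one, Matrix.one_apply_eq]
          subst ha1
          have hvℓ : (Rat.HeightOneSpectrum.primesEquiv u : ℕ) = ℓ := Rat.HeightOneSpectrum.primesEquiv_eq_of_natCast_mem _ hℓprime hu
          have hmultv := Summit.BirchSwinnertonDyer.Rank1Residual.X2.GreenbergVatsalStrictSelmerMultiplicative.hasMultiplicativeReductionAt_of_mem
            W ℓ hm hu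
          push_cast
          rw [inv_one, one_mul]
          -- `a_ℓ = ε ≡ ℓ` by the datum's congruence
          rcases hcong with ⟨hsp, hℓ1⟩ | ⟨hns, hℓ1⟩
          · have hsplitv : W.HasSplitMultiplicativeReductionAt u := by
              refine (WeierstrassCurve.hasSplitMultiplicativeReductionAtPrime_iff_hasSplitMultiplicativeReductionAt W u).mp ?_
              have key : ∀ (q : ℕ) (hq' : Fact q.Prime), q = ℓ → (haveI := hq'; W.HasSplitMultiplicativeReductionAtPrime q) := by
                rintro q hq' rfl; exact hsp
              exact key _ _ hvℓ
            rw [← hvℓ, W.LFunction_apply_primesEquiv_of_hasSplitMultiplicativeReductionAt hsplitv, hvℓ,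
              show ((1 : ℤ) : PadicAlgCl p) - (ℓ : PadicAlgCl p) = (((1 - ℓ : ℤ) : ℚ_[p]) : PadicAlgCl p) by push_cast; rfl,
              PadicAlgCl.norm_extends, Padic.norm_intCast_lt_one_iff]
            exact (Nat.modEq_iff_dvd.mp hℓ1)
          · have hnsv : ¬ W.HasSplitMultiplicativeReductionAt u := by
              intro hsplitv; apply hns
              have h' := (WeierstrassCurve.hasSplitMultiplicativeReductionAtPrime_iff_hasSplitMultiplicativeReductionAt W u).mpr hsplitv
              have key : ∀ (q : ℕ) (hq' : Fact q.Prime), q = ℓ →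
                  (haveI := hq'; W.HasSplitMultiplicativeReductionAtPrime q) → W.HasSplitMultiplicativeReductionAtPrime ℓ := by
                rintro q hq' rfl h''; exact h''
              exact key _ _ hvℓ h'
            rw [← hvℓ, W.LFunction_apply_primesEquiv_of_hasMultiplicativeReductionAt_of_not_split hmultv hnsv, hvℓ,
              show ((-1 : ℤ) : PadicAlgCl p) - (ℓ : PadicAlgCl p) = (((-1 - ℓ : ℤ) : ℚ_[p]) : PadicAlgCl p) by push_cast; rfl,
              PadicAlgCl.norm_extends, Padic.norm_intCast_lt_one_iff]
            have h2 : (p : ℤ) ∣ ((ℓ + 1 : ℕ) : ℤ) - (0 : ℕ) := (Nat.modEq_iff_dvd.mp hℓ1.symm)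
            have e : (-1 - ℓ : ℤ) = -(((ℓ + 1 : ℕ) : ℤ) - (0 : ℕ)) := by push_cast; ring
            rw [e, dvd_neg]; exact h2
        have hmem : ℓ ∈ PF.filter minus := Finset.mem_filter.mpr ⟨hℓPF, hminus⟩
        rw [Finset.prod_eq_zero hmem (sub_self _)]
        ring
    rw [hzero]
    push_cast
    rw [norm_zero]; exact one_pos

end Summit.BirchSwinnertonDyer.BirchSwinnertonDyer.Theorems.GoodLatticeKrizDescentTypeOfDatum

end
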